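import Mathlib
import HarnessLib
import Literature.Analysis.FluidPDE.VectorCalculus
import Summits.NavierStokesRegularity.NavierStokesRegularity.Theorems.UnthreadedRigidityDoorUnthreadedRigidityVirialHornAngularJets
import Summits.NavierStokesRegularity.NavierStokesRegularity.Theorems.UnthreadedRigidityDoorUnthreadedRigidityVirialHornAngularFrame
import Summits.NavierStokesRegularity.NavierStokesRegularity.Theorems.UnthreadedRigidityDoorUnthreadedRigidityPersistenceGradSqAffineZonal
import Summits.NavierStokesRegularity.NavierStokesRegularity.Theorems.UnthreadedDoorKinematicShadowZonalFrame

/-!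
# Route `UnthreadedRigidityDoor`, wall item W2 `UnthreadedRigidity` (stmt-NavierStokesRegularity-27585) — LINE g12-2 «PERSISTENCE FILTER»
# (ns-idea-6 g12, `Persistence_sketch.lean` 09bc8f71301208c4; DIRECTOR-NS #294): support S–M `GradSqAffineLaw` — part (B1), THE MERIDIAN OF A
# ZONAL SOLID HARMONIC: the Legendre relation and the sphere law along a meridian

Seat ns-es-p1 g8 (W2 second queue).  Typed sub-split of `GradSqAffineLaw` (T2 of 3).  Setting: `Y` a solid harmonic of degree `l`, zonal about
a UNIT axis `a` (`det[a, y, ∇Y(y)] ≡ 0`), `b ⊥ a` a unit vector, `c = a × b`; the meridian `γ(θ) = cos θ·a + sin θ·b`, `γ′(θ) = −sin θ·a + cos θ·b`,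
`f = Y ∘ γ`, `f′(θ) = ⟪∇Y(γ), γ′⟫`, `f″(θ) = ⟪D(∇Y)(γ)γ′, γ′⟫ − ⟪∇Y(γ), γ⟫` (all written out; no definitions).

* `exists_orthonormalBasis` — `{a, b, a × b}` is an orthonormal basis (Parseval `sum_sq_inner_right`, trace `LinearMap.trace_eq_sum_inner`).
* `hasDerivAt_meridian`, `hasDerivAt_meridian_deriv` — `f′`, `f″` as displayed.
* `zonal_fderiv` — the zonal identity differentiated: `⟪a × y, D(∇Y)(y) u⟫ + ⟪a × u, ∇Y(y)⟫ = 0`; whence on the meridian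
  `⟪∇Y(γ), c⟫ = 0` (`inner_gradient_cross_eq_zero`) and `sin θ ⟪D(∇Y)(γ) c, c⟫ = ⟪b, ∇Y(γ)⟫`.
* `meridian_normSq` — `|∇Y(γ(θ))|² = f′(θ)² + l² f(θ)²` (Parseval in `{a,b,c}`, Euler `⟪γ, ∇Y(γ)⟫ = l f`).
* `meridian_legendre` — **the Legendre relation** `sin θ·f″ + cos θ·f′ + l(l+1) sin θ·f = 0` (`tr D(∇Y) = 0` in the frame `{a,b,c}`,
  `⟪D(∇Y)γ, γ⟫ = l(l−1)f`, and the zonal identity for the `c c` entry).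

HONEST LABEL: calculus about special separable data (support of a files-only rung line); nothing here bears on `UnthreadedRigidity` (27585), the door
Target, W2 or Navier–Stokes regularity; no summit statement is proved.  MODEL/rung work.
-/

noncomputable section

-- the summit and its single sub-problem share the name (CONVENTIONS §1), as in every Theorems file
set_option linter.dupNamespace false

namespace Summit.NavierStokesRegularity.NavierStokesRegularity.Theorems.UnthreadedRigidity.Persistence

open scoped InnerProductSpace Topology
open Set Filter
open Literature.Analysis.FluidPDE (cross crossCLM crossCLM_apply)
open Summit.NavierStokesRegularity.NavierStokesRegularity.Theorems.UnthreadedRigidity.ProfileHorn (E3)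
open Summit.NavierStokesRegularity.NavierStokesRegularity.Theorems.PoloidalLiouville.KinematicShadow (cross_axis_polarVec)
open Summit.NavierStokesRegularity.NavierStokesRegularity.Theorems.UnthreadedRigidity.VirialHorn
  (e det3 IsSolidHarmonic IsZonalAbout det3_eq_inner_cross_left)

variable {l : ℕ} {Y : E3 → ℝ} {a b : E3}

/-! ## The frame `{a, b, a × b}` -/

/-- the inner product in coordinates. -/
private theorem real_inner_e3 (u v : E3) : ⟪u, v⟫_ℝ = u 0 * v 0 + u 1 * v 1 + u 2 * v 2 := by
  simp [PiLp.inner_apply, Fin.sum_univ_three, mul_comm]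

/-- `a × (a × b) = ⟪a,b⟫ a − ⟪a,a⟫ b`. -/
theorem cross_cross_left (a b : E3) : cross a (cross a b) = ⟪a, b⟫_ℝ • a - ⟪a, a⟫_ℝ • b := by
  rw [real_inner_e3, real_inner_e3]
  ext i
  fin_cases i <;> simp [cross, cross_apply] <;> ring

/-- Lagrange: `|a × b|² = |a|²|b|² − ⟪a,b⟫²` (inner-product form). -/
theorem inner_cross_cross_self (a b : E3) :
    ⟪cross a b, cross a b⟫_ℝ = ⟪a, a⟫_ℝ * ⟪b, b⟫_ℝ - ⟪a, b⟫_ℝ ^ 2 := by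
  rw [real_inner_e3, real_inner_e3, real_inner_e3, real_inner_e3]
  simp [cross, cross_apply]
  ring

/-- For orthonormal `a, b`: `|a × b| = 1`. -/
theorem norm_cross_of_orthonormal (ha : ‖a‖ = 1) (hb : ‖b‖ = 1) (hab : ⟪a, b⟫_ℝ = 0) : ‖cross a b‖ = 1 := by
  have h : ‖cross a b‖ ^ 2 = 1 := by
    rw [← real_inner_self_eq_norm_sq, inner_cross_cross_self, real_inner_self_eq_norm_sq,
      real_inner_self_eq_norm_sq, ha, hb, hab]; norm_num
  nlinarith [norm_nonneg (cross a b)]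

/-- For orthonormal `a, b`: `a × (a × b) = −b`. -/
theorem cross_cross_of_orthonormal (ha : ‖a‖ = 1) (hab : ⟪a, b⟫_ℝ = 0) : cross a (cross a b) = -b := by
  rw [cross_cross_left, hab, real_inner_self_eq_norm_sq, ha]; simp

/-- **`{a, b, a × b}` is an orthonormal basis of `ℝ³`.** -/
theorem exists_orthonormalBasis (ha : ‖a‖ = 1) (hb : ‖b‖ = 1) (hab : ⟪a, b⟫_ℝ = 0) :
    ∃ B : OrthonormalBasis (Fin 3) ℝ E3, B 0 = a ∧ B 1 = b ∧ B 2 = cross a b := by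
  have hba : ⟪b, a⟫_ℝ = 0 := by rw [real_inner_comm]; exact hab
  have hac : ⟪a, cross a b⟫_ℝ = 0 := inner_self_cross a b
  have hbc : ⟪b, cross a b⟫_ℝ = 0 := inner_cross_self a b
  have hca : ⟪cross a b, a⟫_ℝ = 0 := by rw [real_inner_comm]; exact hac
  have hcb : ⟪cross a b, b⟫_ℝ = 0 := by rw [real_inner_comm]; exact hbc
  have hon : Orthonormal ℝ ![a, b, cross a b] := by
    rw [orthonormal_iff_ite]
    intro i j
    have hcn := norm_cross_of_orthonormal ha hb hab
    fin_cases i <;> fin_cases j <;> simp [hab, hba, hac, hbc, hca, hcb, ha, hb, hcn]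
  have hsp : ⊤ ≤ Submodule.span ℝ (Set.range ![a, b, cross a b]) :=
    (hon.linearIndependent.span_eq_top_of_card_eq_finrank (by simp [finrank_euclideanSpace])).ge
  exact ⟨OrthonormalBasis.mk hon hsp, by simp, by simp, by simp⟩

/-- Parseval in the frame `{a, b, a × b}`. -/
theorem parseval_frame (ha : ‖a‖ = 1) (hb : ‖b‖ = 1) (hab : ⟪a, b⟫_ℝ = 0) (v : E3) :
    ⟪a, v⟫_ℝ ^ 2 + ⟪b, v⟫_ℝ ^ 2 + ⟪cross a b, v⟫_ℝ ^ 2 = ‖v‖ ^ 2 := by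
  obtain ⟨B, h0, h1, h2⟩ := exists_orthonormalBasis ha hb hab
  have h := B.sum_sq_inner_right v
  rw [Fin.sum_univ_three, h0, h1, h2] at h
  exact h

/-- The trace of a linear map in the frame `{a, b, a × b}` equals its trace in the standard frame. -/
theorem trace_frame (ha : ‖a‖ = 1) (hb : ‖b‖ = 1) (hab : ⟪a, b⟫_ℝ = 0) (T : E3 →L[ℝ] E3) :
    ∑ i : Fin 3, ⟪T (e i), e i⟫_ℝ = ⟪T a, a⟫_ℝ + ⟪T b, b⟫_ℝ + ⟪T (cross a b), cross a b⟫_ℝ := by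
  obtain ⟨B, h0, h1, h2⟩ := exists_orthonormalBasis ha hb hab
  have hB := LinearMap.trace_eq_sum_inner (T : E3 →ₗ[ℝ] E3) B
  have hE := LinearMap.trace_eq_sum_inner (T : E3 →ₗ[ℝ] E3) (EuclideanSpace.basisFun (Fin 3) ℝ)
  rw [hE, Fin.sum_univ_three, Fin.sum_univ_three, h0, h1, h2] at hB
  simp only [ContinuousLinearMap.coe_coe, EuclideanSpace.basisFun_apply] at hB
  have key : ∀ x : E3, ⟪x, T x⟫_ℝ = ⟪T x, x⟫_ℝ := fun x => real_inner_comm _ _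
  simp only [key] at hB
  rw [Fin.sum_univ_three]
  simp only [e]
  exact hB

/-! ## The meridian `γ(θ) = cos θ·a + sin θ·b` -/

/-- `γ′`. -/
theorem hasDerivAt_gamma (a b : E3) (θ : ℝ) :
    HasDerivAt (fun t => Real.cos t • a + Real.sin t • b) (-Real.sin θ • a + Real.cos θ • b) θ := by
  exact ((Real.hasDerivAt_cos θ).smul_const a).add ((Real.hasDerivAt_sin θ).smul_const b)

/-- `γ″ = −γ`. -/
theorem hasDerivAt_gamma' (a b : E3) (θ : ℝ) :
    HasDerivAt (fun t => -Real.sin t • a + Real.cos t • b) (-(Real.cos θ • a + Real.sin θ • b)) θ := by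
  have e : (-(Real.cos θ • a + Real.sin θ • b)) = -Real.cos θ • a + -Real.sin θ • b := by
    rw [neg_add, ← neg_smul, ← neg_smul]
  rw [e]
  exact ((Real.hasDerivAt_sin θ).neg.smul_const a).add ((Real.hasDerivAt_cos θ).smul_const b)

/-- `|γ(θ)| = 1`. -/
theorem norm_gamma (ha : ‖a‖ = 1) (hb : ‖b‖ = 1) (hab : ⟪a, b⟫_ℝ = 0) (θ : ℝ) :
    ‖Real.cos θ • a + Real.sin θ • b‖ = 1 := by
  have h : ‖Real.cos θ • a + Real.sin θ • b‖ ^ 2 = 1 := by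
    rw [norm_add_sq_real, norm_smul, norm_smul, real_inner_smul_left, real_inner_smul_right, hab, ha, hb,
      Real.norm_eq_abs, Real.norm_eq_abs]
    simp only [mul_one, mul_zero, add_zero, sq_abs]
    exact Real.cos_sq_add_sin_sq θ
  nlinarith [norm_nonneg (Real.cos θ • a + Real.sin θ • b)]

/-- `f′ = ⟪∇Y(γ), γ′⟫`. -/
theorem hasDerivAt_meridian (hY : IsSolidHarmonic l Y) (a b : E3) (θ : ℝ) :
    HasDerivAt (fun t => Y (Real.cos t • a + Real.sin t • b))
      ⟪gradient Y (Real.cos θ • a + Real.sin θ • b), -Real.sin θ • a + Real.cos θ • b⟫_ℝ θ := by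
  have h1 : HasGradientAt Y (gradient Y (Real.cos θ • a + Real.sin θ • b)) (Real.cos θ • a + Real.sin θ • b) :=
    ((hY.contDiff.differentiable (by simp)) _).hasGradientAt
  rw [hasGradientAt_iff_hasFDerivAt] at h1
  have h2 := h1.comp_hasDerivAt θ (hasDerivAt_gamma a b θ)
  simpa [InnerProductSpace.toDual_apply_apply, Function.comp_def] using h2

/-- `∇Y ∘ γ` has derivative `D(∇Y)(γ) γ′`. -/
theorem hasDerivAt_gradient_meridian (hY : IsSolidHarmonic l Y) (a b : E3) (θ : ℝ) :
    HasDerivAt (fun t => gradient Y (Real.cos t • a + Real.sin t • b))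
      (fderiv ℝ (gradient Y) (Real.cos θ • a + Real.sin θ • b) (-Real.sin θ • a + Real.cos θ • b)) θ := by
  have hg : HasFDerivAt (gradient Y) (fderiv ℝ (gradient Y) (Real.cos θ • a + Real.sin θ • b))
      (Real.cos θ • a + Real.sin θ • b) :=
    ((hY.contDiff_gradient.differentiable (by simp)) _).hasFDerivAt
  have h := hg.comp_hasDerivAt θ (hasDerivAt_gamma a b θ)
  simpa [Function.comp_def] using h

/-- `f″ = ⟪D(∇Y)(γ)γ′, γ′⟫ − ⟪∇Y(γ), γ⟫`. -/
theorem hasDerivAt_meridian_deriv (hY : IsSolidHarmonic l Y) (a b : E3) (θ : ℝ) :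
    HasDerivAt (fun t => ⟪gradient Y (Real.cos t • a + Real.sin t • b), -Real.sin t • a + Real.cos t • b⟫_ℝ)
      (⟪fderiv ℝ (gradient Y) (Real.cos θ • a + Real.sin θ • b) (-Real.sin θ • a + Real.cos θ • b),
          -Real.sin θ • a + Real.cos θ • b⟫_ℝ
        - ⟪gradient Y (Real.cos θ • a + Real.sin θ • b), Real.cos θ • a + Real.sin θ • b⟫_ℝ) θ := by
  have h := (hasDerivAt_gradient_meridian hY a b θ).inner ℝ (hasDerivAt_gamma' a b θ)
  have e : ⟪gradient Y (Real.cos θ • a + Real.sin θ • b), -(Real.cos θ • a + Real.sin θ • b)⟫_ℝ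
      + ⟪fderiv ℝ (gradient Y) (Real.cos θ • a + Real.sin θ • b) (-Real.sin θ • a + Real.cos θ • b),
          -Real.sin θ • a + Real.cos θ • b⟫_ℝ
      = ⟪fderiv ℝ (gradient Y) (Real.cos θ • a + Real.sin θ • b) (-Real.sin θ • a + Real.cos θ • b),
          -Real.sin θ • a + Real.cos θ • b⟫_ℝ
        - ⟪gradient Y (Real.cos θ • a + Real.sin θ • b), Real.cos θ • a + Real.sin θ • b⟫_ℝ := by
    rw [inner_neg_right]; ring
  rw [e] at h
  exact h

/-! ## The zonal identity differentiated -/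

/-- **The zonal identity differentiated**: `⟪a × y, D(∇Y)(y) u⟫ + ⟪a × u, ∇Y(y)⟫ = 0`. -/
theorem zonal_fderiv (hY : IsSolidHarmonic l Y) (hZ : IsZonalAbout a Y) (y u : E3) :
    ⟪cross a y, fderiv ℝ (gradient Y) y u⟫_ℝ + ⟪cross a u, gradient Y y⟫_ℝ = 0 := by
  have hfun : (fun z : E3 => ⟪crossCLM a z, gradient Y z⟫_ℝ) = fun _ => (0 : ℝ) := by
    funext z
    rw [crossCLM_apply, ← det3_eq_inner_cross_left]
    exact hZ z
  have hg : HasFDerivAt (gradient Y) (fderiv ℝ (gradient Y) y) y :=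
    ((hY.contDiff_gradient.differentiable (by simp)) y).hasFDerivAt
  have h1 : HasFDerivAt (fun z : E3 => ⟪crossCLM a z, gradient Y z⟫_ℝ)
      ((fderivInnerCLM ℝ (crossCLM a y, gradient Y y)).comp ((crossCLM a).prod (fderiv ℝ (gradient Y) y))) y :=
    (crossCLM a).hasFDerivAt.inner ℝ hg
  rw [hfun] at h1
  have h2 := h1.unique (hasFDerivAt_const (0 : ℝ) y)
  have h3 := congrArg (fun L : E3 →L[ℝ] ℝ => L u) h2
  simp only [ContinuousLinearMap.comp_apply, ContinuousLinearMap.prod_apply, fderivInnerCLM_apply,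
    crossCLM_apply] at h3
  simpa using h3

-- (`a × γ(θ) = sin θ·(a × b)` is the tree's `KinematicShadow.cross_axis_polarVec`; `a × a = 0` is `KinematicShadow.PointSource.cross_self`.)

/-- On the meridian of a zonal solid harmonic the gradient has no `a × b` component. -/
theorem inner_gradient_cross_eq_zero (hY : IsSolidHarmonic l Y) (hZ : IsZonalAbout a Y) (b : E3) (θ : ℝ) :
    ⟪cross a b, gradient Y (Real.cos θ • a + Real.sin θ • b)⟫_ℝ = 0 := by
  have h0 : Real.sin θ * ⟪cross a b, gradient Y (Real.cos θ • a + Real.sin θ • b)⟫_ℝ = 0 := by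
    have h := hZ (Real.cos θ • a + Real.sin θ • b)
    rw [det3_eq_inner_cross_left, cross_axis_polarVec, inner_smul_left] at h
    simpa using h
  by_cases hs : Real.sin θ = 0
  · have h := zonal_fderiv hY hZ (Real.cos θ • a + Real.sin θ • b) b
    rw [cross_axis_polarVec, real_inner_smul_left] at h
    have h2 : Real.sin θ * ⟪cross a b, fderiv ℝ (gradient Y) (Real.cos θ • a + Real.sin θ • b) b⟫_ℝ = 0 := by
      rw [hs, zero_mul]
    linarith
  · exact (mul_eq_zero.1 h0).resolve_left hs

/-- The `c c` entry of the Hessian on the meridian: `sin θ ⟪D(∇Y)(γ) c, c⟫ = ⟪b, ∇Y(γ)⟫` (`c = a × b`). -/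
theorem sin_mul_hessian_cross (hY : IsSolidHarmonic l Y) (hZ : IsZonalAbout a Y) (ha : ‖a‖ = 1) (hab : ⟪a, b⟫_ℝ = 0)
    (θ : ℝ) :
    Real.sin θ * ⟪fderiv ℝ (gradient Y) (Real.cos θ • a + Real.sin θ • b) (cross a b), cross a b⟫_ℝ
      = ⟪b, gradient Y (Real.cos θ • a + Real.sin θ • b)⟫_ℝ := by
  have h := zonal_fderiv hY hZ (Real.cos θ • a + Real.sin θ • b) (cross a b)
  rw [cross_axis_polarVec, cross_cross_of_orthonormal ha hab, real_inner_smul_left, inner_neg_left] at h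
  have hc : ⟪cross a b, fderiv ℝ (gradient Y) (Real.cos θ • a + Real.sin θ • b) (cross a b)⟫_ℝ
      = ⟪fderiv ℝ (gradient Y) (Real.cos θ • a + Real.sin θ • b) (cross a b), cross a b⟫_ℝ := real_inner_comm _ _
  rw [hc] at h
  linarith

/-! ## The sphere law and the Legendre relation along the meridian -/

/-- `⟪γ, ∇Y(γ)⟫ = l f` and the `a`, `b` components of `∇Y(γ)` through `f′`. -/
theorem inner_frame_gradient (hY : IsSolidHarmonic l Y) (a b : E3) (θ : ℝ) :
    ⟪a, gradient Y (Real.cos θ • a + Real.sin θ • b)⟫_ℝ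
        = Real.cos θ * ((l : ℝ) * Y (Real.cos θ • a + Real.sin θ • b))
          - Real.sin θ * ⟪gradient Y (Real.cos θ • a + Real.sin θ • b), -Real.sin θ • a + Real.cos θ • b⟫_ℝ ∧
      ⟪b, gradient Y (Real.cos θ • a + Real.sin θ • b)⟫_ℝ
        = Real.sin θ * ((l : ℝ) * Y (Real.cos θ • a + Real.sin θ • b))
          + Real.cos θ * ⟪gradient Y (Real.cos θ • a + Real.sin θ • b), -Real.sin θ • a + Real.cos θ • b⟫_ℝ := by
  set g := gradient Y (Real.cos θ • a + Real.sin θ • b) with hg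
  have hE : ⟪Real.cos θ • a + Real.sin θ • b, g⟫_ℝ = (l : ℝ) * Y (Real.cos θ • a + Real.sin θ • b) :=
    hY.inner_self_gradient _
  rw [inner_add_left, real_inner_smul_left, real_inner_smul_left] at hE
  have hτ : ⟪g, -Real.sin θ • a + Real.cos θ • b⟫_ℝ = -Real.sin θ * ⟪a, g⟫_ℝ + Real.cos θ * ⟪b, g⟫_ℝ := by
    rw [inner_add_right, real_inner_smul_right, real_inner_smul_right, real_inner_comm a g, real_inner_comm b g]
  have hsc := Real.sin_sq_add_cos_sq θ
  rw [hτ]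
  constructor
  · linear_combination Real.cos θ * hE - ⟪a, g⟫_ℝ * hsc
  · linear_combination Real.sin θ * hE - ⟪b, g⟫_ℝ * hsc

/-- **The sphere law along the meridian**: `|∇Y(γ)|² = f′² + l² f²`. -/
theorem meridian_normSq (hY : IsSolidHarmonic l Y) (hZ : IsZonalAbout a Y) (ha : ‖a‖ = 1) (hb : ‖b‖ = 1)
    (hab : ⟪a, b⟫_ℝ = 0) (θ : ℝ) :
    ‖gradient Y (Real.cos θ • a + Real.sin θ • b)‖ ^ 2
      = ⟪gradient Y (Real.cos θ • a + Real.sin θ • b), -Real.sin θ • a + Real.cos θ • b⟫_ℝ ^ 2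
        + (l : ℝ) ^ 2 * Y (Real.cos θ • a + Real.sin θ • b) ^ 2 := by
  obtain ⟨h1, h2⟩ := inner_frame_gradient hY a b θ
  rw [← parseval_frame ha hb hab, inner_gradient_cross_eq_zero hY hZ b θ, h1, h2]
  have hsc := Real.sin_sq_add_cos_sq θ
  linear_combination ((⟪gradient Y (Real.cos θ • a + Real.sin θ • b), -Real.sin θ • a + Real.cos θ • b⟫_ℝ) ^ 2
    + (l : ℝ) ^ 2 * Y (Real.cos θ • a + Real.sin θ • b) ^ 2) * hsc

/-- **The Legendre relation along the meridian**: `sin θ·f″ + cos θ·f′ + l(l+1) sin θ·f = 0`. -/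
theorem meridian_legendre (hY : IsSolidHarmonic l Y) (hZ : IsZonalAbout a Y) (ha : ‖a‖ = 1) (hb : ‖b‖ = 1)
    (hab : ⟪a, b⟫_ℝ = 0) (θ : ℝ) :
    Real.sin θ * (⟪fderiv ℝ (gradient Y) (Real.cos θ • a + Real.sin θ • b) (-Real.sin θ • a + Real.cos θ • b),
          -Real.sin θ • a + Real.cos θ • b⟫_ℝ
        - ⟪gradient Y (Real.cos θ • a + Real.sin θ • b), Real.cos θ • a + Real.sin θ • b⟫_ℝ)
      + Real.cos θ * ⟪gradient Y (Real.cos θ • a + Real.sin θ • b), -Real.sin θ • a + Real.cos θ • b⟫_ℝ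
      + (l : ℝ) * ((l : ℝ) + 1) * Real.sin θ * Y (Real.cos θ • a + Real.sin θ • b) = 0 := by
  set y := Real.cos θ • a + Real.sin θ • b with hy
  set τ := -Real.sin θ • a + Real.cos θ • b with hτ
  set S := fderiv ℝ (gradient Y) y with hS
  set g := gradient Y y with hg
  -- trace zero in the frame `{a, b, c}`
  have htr : ⟪S a, a⟫_ℝ + ⟪S b, b⟫_ℝ + ⟪S (cross a b), cross a b⟫_ℝ = 0 := by
    rw [← trace_frame ha hb hab S]; exact hY.trace_hessian y
  -- `⟪S a, a⟫ + ⟪S b, b⟫ = ⟪S y, y⟫ + ⟪S τ, τ⟫`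
  have hrot : ⟪S a, a⟫_ℝ + ⟪S b, b⟫_ℝ = ⟪S y, y⟫_ℝ + ⟪S τ, τ⟫_ℝ := by
    have hsc := Real.sin_sq_add_cos_sq θ
    rw [hy, hτ]
    simp only [map_add, map_smul, map_neg, inner_add_left, inner_add_right, inner_smul_left, inner_smul_right,
      inner_neg_left, inner_neg_right, neg_smul, conj_trivial]
    linear_combination (-(⟪S a, a⟫_ℝ) - ⟪S b, b⟫_ℝ) * hsc
  -- Euler: `⟪S y, y⟫ = (l−1) l f`, `⟪y, g⟫ = l f`
  have hE1 : ⟪y, g⟫_ℝ = (l : ℝ) * Y y := hY.inner_self_gradient y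
  have hE2 : ⟪S y, y⟫_ℝ = ((l : ℝ) - 1) * ((l : ℝ) * Y y) := by
    rw [hS, hY.hessian_apply_self y, real_inner_smul_left, ← hg, real_inner_comm y g, hE1]
  -- the `c c` entry and the `b` component
  have hcc := sin_mul_hessian_cross hY hZ ha hab θ
  obtain ⟨-, hbg⟩ := inner_frame_gradient hY a b θ
  rw [← hy] at hcc hbg
  rw [← hτ] at hbg
  rw [← hS, ← hg] at hcc
  rw [← hg] at hbg
  rw [real_inner_comm y g]
  -- assemble: the trace identity times `sin θ`
  linear_combination Real.sin θ * htr - Real.sin θ * hrot - Real.sin θ * hE2 - hcc - hbg - Real.sin θ * hE1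

end Summit.NavierStokesRegularity.NavierStokesRegularity.Theorems.UnthreadedRigidity.Persistence

end
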